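import Summits.HubbardSuperconductivity.HubbardSuperconductivity.Theses.IsoperimetricCascade
import Summits.HubbardSuperconductivity.HubbardSuperconductivity.Theorems.TwTipContinuation.Negative.TipNormalForm

/-!
# Route `IsoperimetricCascade` — glue supports `CruxesGiveCascade` (stmt-HubbardSuperconductivity-11984)
# and `FloorToSummit` (stmt-HubbardSuperconductivity-11986)

* `CruxesGiveCascade : IsoperimetricInequality → OverlapRate → IsoCascade` — take the witness
  `(U, δ) ∈ [2,8] × [1/10, 2/5]` of the isoperimetric inequality (so `U > 0`, `δ ∈ (0, 1/2)`), the
  overlap data `(r, γ, L₀')` of `OverlapRate` at that point, and the isoperimetric inequality at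
  that `r` with `ε := e - 1 > 0`, so that `(1 + ε)^n = e^n = exp (1 · n)`; `C := 1`,
  `L₀ := max L₀ L₀'`. Pure logic plus `Real.exp_one_pow`.
* `FloorToSummit : PairFieldFloor → HubbardSuperconductivity` — the floor is stated with
  `‖Δ ψ‖² = re ⟨Δψ, Δψ⟩`; rewriting `⟨ψ, Δᴴ Δ ψ⟩ = ⟨Δ ψ, Δ ψ⟩` turns it into the every-ground-state
  order floor `a L⁴ ≤ re ⟨ψ, Δᴴ Δ ψ⟩` at even `L ≥ L₀`, and the summit at `(U, δ)` is the tree's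
  even-side `liminf` bookkeeping `summitMatrix_of_everyGSOrder`
  (`Theorems/TwTipContinuation/Negative/TipNormalForm.lean`).

Sources: A. J. Coleman, J. Math. Phys. 6 (1965) 1425 (AGP / geminal powers — the route's setting);
D. J. Scalapino, Phys. Rep. 250 (1995) 329, §2 (order parameter). No new definitions.
-/

-- the mandated namespace `Summit.<Summit>.<Problem>.Theorems` repeats `HubbardSuperconductivity`
-- (single-problem summit, D-0017), which the `dupNamespace` linter flags on every declaration
set_option linter.dupNamespace false

namespace Summit.HubbardSuperconductivity.HubbardSuperconductivity.Theorems

open Matrix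
open Literature.MathematicalPhysics.QuantumLattice Literature.Probability.LatticeModels
open Summit.HubbardSuperconductivity.TwTipContinuation.Negative (summitMatrix_of_everyGSOrder)

/-- **Cruxes ⇒ cascade** (item `stmt-HubbardSuperconductivity-11984`, `CruxesGiveCascade`):
`IsoperimetricInequality → OverlapRate → IsoCascade` with `C := 1` (choose `ε := e - 1` in the
isoperimetric inequality, so `(1+ε)^n = exp (1 · n)`), the overlap rate's `(r, γ)` and
`L₀ := max` of the two thresholds. [folklore] -/
theorem cruxesGiveCascade_proof :
    Summit.HubbardSuperconductivity.HubbardSuperconductivity.Theses.IsoperimetricCascade.CruxesGiveCascade := by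
  unfold Summit.HubbardSuperconductivity.HubbardSuperconductivity.Theses.IsoperimetricCascade.CruxesGiveCascade
    Summit.HubbardSuperconductivity.HubbardSuperconductivity.Theses.IsoperimetricCascade.IsoperimetricInequality
    Summit.HubbardSuperconductivity.HubbardSuperconductivity.Theses.IsoperimetricCascade.OverlapRate
    Summit.HubbardSuperconductivity.HubbardSuperconductivity.Theses.IsoperimetricCascade.IsoCascade
  rintro ⟨U, hU, δ, hδ, hIso⟩ hOv
  obtain ⟨r, γ, L₁, hOvr⟩ := hOv U hU δ hδ
  have hε : (0 : ℝ) < Real.exp 1 - 1 := by linarith [Real.add_one_lt_exp (one_ne_zero (α := ℝ))]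
  obtain ⟨L₂, hIsor⟩ := hIso r (Real.exp 1 - 1) hε
  have hU0 : 0 < U := by linarith [hU.1]
  have hδ' : δ ∈ Set.Ioo (0 : ℝ) (1 / 2) := ⟨by linarith [hδ.1], by linarith [hδ.2]⟩
  refine ⟨U, hU0, δ, hδ', r, 1, γ, max L₁ L₂, ?_⟩
  intro L _ hL hEv ψ hψ1 hψ
  have key := hIsor L (le_of_max_le_right hL) hEv ψ hψ1 hψ
  have key2 := hOvr L (le_of_max_le_left hL) hEv ψ hψ1 hψ
  dsimp only at key key2 ⊢
  refine ⟨?_, key2⟩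
  have hpow : (1 + (Real.exp 1 - 1)) ^ (⌊(1 - δ) * (L : ℝ) ^ 2 / 2⌋₊ - r) =
      Real.exp (1 * ((⌊(1 - δ) * (L : ℝ) ^ 2 / 2⌋₊ - r : ℕ) : ℝ)) := by
    rw [add_sub_cancel, one_mul, ← Real.exp_one_pow]
  rw [hpow] at key
  exact key

/-- **Floor ⇒ summit** (item `stmt-HubbardSuperconductivity-11986`, `FloorToSummit`):
`PairFieldFloor → HubbardSuperconductivity`. With `⟨ψ, Δᴴ Δ ψ⟩ = ⟨Δ ψ, Δ ψ⟩` the floor is the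
uniform every-ground-state order bound `a L⁴ ≤ re ⟨ψ, Δᴴ Δ ψ⟩` at even `L ≥ L₀`, and the summit at
`(U, δ)` follows by `summitMatrix_of_everyGSOrder`. Scalapino, Phys. Rep. 250 (1995) 329, §2.
[folklore] -/
theorem floorToSummit_proof :
    Summit.HubbardSuperconductivity.HubbardSuperconductivity.Theses.IsoperimetricCascade.FloorToSummit := by
  unfold Summit.HubbardSuperconductivity.HubbardSuperconductivity.Theses.IsoperimetricCascade.FloorToSummit
    Summit.HubbardSuperconductivity.HubbardSuperconductivity.Theses.IsoperimetricCascade.PairFieldFloor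
  rintro ⟨U, hU, δ, hδ, a, ha, L₀, h⟩
  show Literature.Hubbard.DWaveSuperconductivityHubbard
  refine ⟨U, hU, δ, hδ, summitMatrix_of_everyGSOrder ⟨a, ha, L₀, ?_⟩⟩
  intro L _ hL hEv ψ hψ1 hψ
  have key := h L hL hEv ψ hψ1 hψ
  have hid : expect ((pairField dWaveFormFactor L)ᴴ * pairField dWaveFormFactor L) ψ =
      star (pairField dWaveFormFactor L *ᵥ ψ) ⬝ᵥ (pairField dWaveFormFactor L *ᵥ ψ) := by
    unfold expect
    rw [← mulVec_mulVec, dotProduct_mulVec, star_mulVec]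
  rw [hid]
  exact key

end Summit.HubbardSuperconductivity.HubbardSuperconductivity.Theorems
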